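import Summits.BirchSwinnertonDyer.BirchSwinnertonDyer.Theorems.ManinLocalTwoThreeConwayNortonSameLevelTwist
import HarnessLib

/-!
# E-desc-52 `EisensteinDepthTwistLipschitz` HOLDS: the `f`- and `f ⊗ χ₋₃`-planes of the Conway–Norton lattice `M^G(N)`
# have equal prime-to-`3` index and `(√−3)`-depths differing by at most one (`9 ∣ N`, same-level newform pair)

Summit `BirchSwinnertonDyer`, sub-problem `BirchSwinnertonDyer`, route `ManinLocalTwoThree` (Manin constant at the
additive primes `2, 3`); width seat `bsd-line-manin23-p2` (gen 9), `--supports` the crux C3 `ManinPrimeToThreeAtNine`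
(stmt-BirchSwinnertonDyer-22968).  Cell `bsd-f2-manin`, descent lens desc g8 (MEMO-desc §25.3, typed `@[conjecture]`
leaf `…ManinAdditive.ConwayNortonThree.EisensteinDepthTwistLipschitz`, p636155); refuter-1 §R64 «THEOREM TARGET VALID on
paper», land order «E-desc-51′ (typer p636828) → E-desc-54 (this seat g8, p637920) → E-desc-52» — this file is the
third step; desc g10 MEMO-desc §27.1 (answer to this seat's gap note: `f, f ⊗ χ ∈ M^G` on rational pairs, P-desc-2).

PROVED here (sorry-free, axioms `propext`, `Classical.choice`, `Quot.sound`):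

* **`eisensteinDepthTwistLipschitz_holds : EisensteinDepthTwistLipschitz`** (E-desc-52 BY NAME).

Proof.  `M = M^G(N)` is stable under `D = t_{1/3} − t_{2/3} = (ζ₃ − ζ₃²)·B₃` (`…PlaneIndexTransport`); `B₃ f = g`,
`B₃ g = f` (`g = f ⊗ χ₋₃`; E-desc-51′ and `3`-depletion) and `B₃` is Petersson self-adjoint (this seat's g8
`peterssonProduct_twistOperatorAtThree_left`), so with `L_h = ⟨h, ·⟩`: `π·L_f(M) = L_g(DM) ⊆ L_g(M)` and symmetrically
(`π = ζ₃ − ζ₃²`).  By `planeIndex_eq_relIndex`, `planeIndex M h = [L_h(M) : Λ_h]`, `Λ_h = L_h(M ∩ (ℤh + ℤζ₃h))`, and the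
two index chains below `L_g(M)` ending at `πΛ` give `planeIndex M f ∣ [Λ : πΛ] · planeIndex M g` once `Λ_f = Λ_g = Λ ⊇ πΛ`.
DICHOTOMY (`…ConwayNortonSameLevelTwist`): if `f` has integer coefficients then `f, g ∈ M` (P-desc-2), so
`Λ_f = Λ_g = ℤc + ℤζ₃c` with `c = ⟨f,f⟩ = ⟨g,g⟩` and `[Λ : πΛ] ∣ 3`; otherwise `M ∩ (ℤf + ℤζ₃f) = M ∩ (ℤg + ℤζ₃g) = 0`
(newform coefficients are real algebraic integers), `Λ_f = Λ_g = 0`, `[Λ : πΛ] = 1`.  Either way `a ∣ 3b ∧ b ∣ 3a` for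
the two plane indices, whence equal prime-to-`3` parts and `|v₃ a − v₃ b| ≤ 1`
(`div_pow_eq_and_natAbs_sub_le_one_of_dvd_three_mul`; the infinite-index junk case `a = b = 0` included).

Census of record (desc g8, HOME/desc/g8/out/pairstats.txt): 74 directed same-level pairs, `r₀` equal 74/74, `|Δk| ≤ 1`
74/74.  E-blind; elementary (Atkin–Lehner 1970 §4 normaliser bookkeeping, Diamond–Shurman §5.5 adjoints, Shimura 1971
Thm. 3.48).  BSD is not proved by this; Manin's conjecture is not proved by this; C3 is not closed by this.
-/

set_option autoImplicit false
set_option linter.dupNamespace false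

noncomputable section

open scoped MatrixGroups ModularForm ComplexConjugate
open CongruenceSubgroup
open Literature.NumberTheory.EllipticCurves Literature.NumberTheory.EllipticCurves.ModularForms
open Summit.BirchSwinnertonDyer.Rank1Residual.ManinAdditive
open Summit.BirchSwinnertonDyer.Rank1Residual.ManinAdditive.RamanujanCut
open Summit.BirchSwinnertonDyer.Rank1Residual.ManinAdditive.ConwayNortonThree

namespace Summit.BirchSwinnertonDyer.BirchSwinnertonDyer.Theorems.ManinLocalTwoThree

/-! ### E-desc-52 by name -/

/-- **E-desc-52 `EisensteinDepthTwistLipschitz` HOLDS** (cell `bsd-f2-manin`, desc g8 theorem target, MEMO-desc §25.3;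
refuter-1 §R64 «VALID on paper»; desc g10 MEMO-desc §27.1): for `9 ∣ N` and newforms `f`, `f ⊗ χ₋₃` both of level `N`,
the `f`- and `f ⊗ χ₋₃`-planes of the Conway–Norton lattice `M^G(N)` have equal prime-to-`3` index and `(√−3)`-adic
depths differing by at most one.  Proof: `D = (ζ₃ − ζ₃²) B₃ = t_{1/3} − t_{1/3}²` preserves `M^G`, `B₃` swaps `f` and
`g = f ⊗ χ₋₃` and is Petersson self-adjoint, so `π⟨f, M^G⟩ ⊆ ⟨g, M^G⟩` and vice versa (`π = ζ₃ − ζ₃²`); with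
`planeIndex M h = [⟨h, M⟩ : ⟨h, M ∩ (ℤh + ℤζ₃h)⟩]` the two index chains give `a ∣ 3b`, `b ∣ 3a` provided the two
lines `⟨h, M ∩ (ℤh + ℤζ₃h)⟩` agree and have `[Λ : πΛ] ∣ 3`.  RATIONAL `f`: `f, g ∈ M^G` (P-desc-2,
`memConwayNortonLatticeAtThree_of_sameLevelTwist`), both lines are `ℤc + ℤζ₃c` with `c = ⟨f,f⟩ = ⟨g,g⟩`, index `3`.
NON-RATIONAL `f`: both intersections vanish (reality + integrality of newform coefficients), both lines are `0`.
BSD is not proved by this; Manin's conjecture is not proved by this. -/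
theorem eisensteinDepthTwistLipschitz_holds : EisensteinDepthTwistLipschitz := by
  intro N _ h9 χ hχ hprim f hf hg
  have h9' : 9 ∣ N := by simpa using h9
  have hfg : twistOperatorAtThree N 2 f = charTwist N dvd_rfl h9 hχ f := twistOperatorEqCharTwist_holds N h9 χ hχ hprim f
  have hgf : twistOperatorAtThree N 2 (charTwist N dvd_rfl h9 hχ f) = f :=
    twistOperatorAtThree_charTwist_of_isNewform0 h9 hχ hprim hf
  have hD : ∀ x ∈ conwayNortonLatticeAtThree N,
      (zeta3 - zeta3 ^ 2) • twistOperatorAtThree N 2 x ∈ conwayNortonLatticeAtThree N :=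
    fun x hx => smul_twistOperatorAtThree_mem_conwayNortonLatticeAtThree h9' hx
  obtain ⟨g, hgdef⟩ : ∃ g, charTwist N dvd_rfl h9 hχ f = g := ⟨_, rfl⟩
  have hgint : (∀ n : ℕ, ∃ a : ℤ, cuspCoeff g n = a) → ∀ n : ℕ, ∃ a : ℤ, cuspCoeff f n = a := by
    rw [← hgdef]; exact int_cuspCoeff_of_int_cuspCoeff_charTwist h9 hχ hprim hf
  have hmem : (∀ n : ℕ, ∃ a : ℤ, cuspCoeff f n = a) →
      f ∈ conwayNortonLatticeAtThree N ∧ g ∈ conwayNortonLatticeAtThree N := by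
    rw [← hgdef]; exact memConwayNortonLatticeAtThree_of_sameLevelTwist h9 hχ hprim hf hg
  rw [hgdef] at hfg hgf hg ⊢
  set M := conwayNortonLatticeAtThree N with hMdef
  suffices key : planeIndex M f ∣ 3 * planeIndex M g ∧ planeIndex M g ∣ 3 * planeIndex M f by
    exact div_pow_eq_and_natAbs_sub_le_one_of_dvd_three_mul key.1 key.2
  by_cases hint : ∀ n : ℕ, ∃ a : ℤ, cuspCoeff f n = a
  · -- RATIONAL branch: `f, g ∈ M^G`, both lines `ℤc + ℤζ₃c`
    obtain ⟨hfM, hgM⟩ := hmem hint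
    have hPf : (ℤ ∙ f) ⊔ (ℤ ∙ (zeta3 • f)) ≤ M :=
      sup_le ((Submodule.span_singleton_le_iff_mem _ _).mpr hfM)
        ((Submodule.span_singleton_le_iff_mem _ _).mpr (zeta3_smul_mem_conwayNortonLatticeAtThree hfM))
    have hPg : (ℤ ∙ g) ⊔ (ℤ ∙ (zeta3 • g)) ≤ M :=
      sup_le ((Submodule.span_singleton_le_iff_mem _ _).mpr hgM)
        ((Submodule.span_singleton_le_iff_mem _ _).mpr (zeta3_smul_mem_conwayNortonLatticeAtThree hgM))
    have hc : peterssonProduct (Gamma0 N) 2 g g = peterssonProduct (Gamma0 N) 2 f f := by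
      calc peterssonProduct (Gamma0 N) 2 g g = peterssonProduct (Gamma0 N) 2 g (twistOperatorAtThree N 2 f) := by
              rw [hfg]
        _ = peterssonProduct (Gamma0 N) 2 (twistOperatorAtThree N 2 g) f :=
              (peterssonProduct_twistOperatorAtThree_left 2 g f).symm
        _ = peterssonProduct (Gamma0 N) 2 f f := by rw [hgf]
    have hΛf := map_inf_eq_closure_of_le hPf
    have hΛg := map_inf_eq_closure_of_le hPg
    rw [hc] at hΛg
    constructor
    · refine planeIndex_dvd_three_mul_planeIndex hD hgf (hΛf.trans hΛg.symm) ?_ ?_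
      · rw [hΛf]; exact map_mulLeft_closure_pair_le _
      · rw [hΛf]; exact relIndex_map_mulLeft_closure_pair_dvd_three _
    · refine planeIndex_dvd_three_mul_planeIndex hD hfg (hΛg.trans hΛf.symm) ?_ ?_
      · rw [hΛg]; exact map_mulLeft_closure_pair_le _
      · rw [hΛg]; exact relIndex_map_mulLeft_closure_pair_dvd_three _
  · -- NON-RATIONAL branch: both intersections vanish
    have hbf : M ⊓ ((ℤ ∙ f) ⊔ (ℤ ∙ (zeta3 • f))) = ⊥ := conwayNortonLatticeAtThree_inf_span_pair_eq_bot hf hint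
    have hbg : M ⊓ ((ℤ ∙ g) ⊔ (ℤ ∙ (zeta3 • g))) = ⊥ :=
      conwayNortonLatticeAtThree_inf_span_pair_eq_bot hg fun h => hint (hgint h)
    have hΛf : (M ⊓ ((ℤ ∙ f) ⊔ (ℤ ∙ (zeta3 • f)))).toAddSubgroup.map (peterssonProductₗ (Gamma0 N) 2 f).toAddMonoidHom
        = ⊥ := by rw [hbf, Submodule.bot_toAddSubgroup, AddSubgroup.map_bot]
    have hΛg : (M ⊓ ((ℤ ∙ g) ⊔ (ℤ ∙ (zeta3 • g)))).toAddSubgroup.map (peterssonProductₗ (Gamma0 N) 2 g).toAddMonoidHom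
        = ⊥ := by rw [hbg, Submodule.bot_toAddSubgroup, AddSubgroup.map_bot]
    constructor
    · refine planeIndex_dvd_three_mul_planeIndex hD hgf (hΛf.trans hΛg.symm) ?_ ?_
      · rw [hΛf, AddSubgroup.map_bot]
      · rw [hΛf, AddSubgroup.map_bot, AddSubgroup.relIndex_bot_right]; exact one_dvd _
    · refine planeIndex_dvd_three_mul_planeIndex hD hfg (hΛg.trans hΛf.symm) ?_ ?_
      · rw [hΛg, AddSubgroup.map_bot]
      · rw [hΛg, AddSubgroup.map_bot, AddSubgroup.relIndex_bot_right]; exact one_dvd _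

end Summit.BirchSwinnertonDyer.BirchSwinnertonDyer.Theorems.ManinLocalTwoThree

end
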